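import Summits.Ventures.QEC.Census.BB.BB784Data
import Summits.Ventures.QEC.Census.BB.BB784RedZ
import Summits.Ventures.QEC.Census.RankRREF
import HarnessLib

/-!
# `[[784,24,≤24]]` (BB.bb784): `rank₂ H^Z = 380`, chunked masks-only RREF certificate — part m3 (mask chunk 3 of 4; one chunk per FILE: the kernel cost of re-deriving reduced rows is superlinear per process, ≈ 13 s / 95 rows but > 600 s / 380)

`BB.bb784` = `QC(x²⁶+y⁶+y⁸, y⁷+x⁹+x²⁰)` on `ℤ₂₈ × ℤ₁₄` [BravyiEtAl2024, §5] (arXiv:2308.07915 chunk p0011 L41–47); rows `BBRows.rowsZ la lb`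
and pivots `pivZ` from `Census/BB/BB784Data.lean`, masks/reduced rows in chunks from `BB784RedZ.lean`. Part a: every reduced row
re-derived from its mask (`masksOKL`, four chunks of 95, `decide +kernel` each) and every check row re-assembled from its pivot bits
(`redSelL`). Parts b/c: unit pivot columns over index ranges (`List.range'` chunks, `decide +kernel` each); part c assembles
`pivotsOK` (`Census/RankPivotChunks.pivotsOK_of_forall`) and the rank (`Census/RankRREFAppend.rank_rowMatrix_of_parts`), transported to
`BB.bb784.HZFlat` along `rowsZ_obj`. Tier KERNEL; axioms standard; no `native_decide`. HONEST FRAMING: a rank only.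
-/

namespace Summit.Ventures.QEC.Census.BB784

open Matrix Literature.InformationTheory.QuantumCodes Summit.Ventures.QEC.Census BBRows

/-- Mask chunk 3: each of its 95 reduced rows IS the mask-selected XOR of the kernel-computed `H^Z` rows (`decide +kernel`). -/
theorem maskZ3_ok : masksOKL (rowsZ la lb) rZ3 mZ3 = true := by
  decide +kernel

end Summit.Ventures.QEC.Census.BB784
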